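import Summits.Parity.BatemanHorn.Theses.RoughValueTransport
import Summits.Parity.BatemanHorn.Theorems.RoughValueTransportRoughValueLawLinearRoughValueLaw
import Literature.NumberTheory.Sieve.RoughOmegaCellsAsymptoticDensity
import Literature.NumberTheory.Sieve.RoughOmegaCellsClassesEquidistribution
import Literature.NumberTheory.Sieve.RoughCellDensity
import HarnessLib

/-!
# Crux `RoughValueLaw` (stmt-Parity-11390), line `omega-class-shape-split`: stub `stub_linearCells`

`--supports` file of the checked skeleton
`Summits/Parity/BatemanHorn/Cruxes/RoughValueLaw/Lines/omega-class-shape-split.lean`; it PROVES the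
registered stub `stub_linearCells` verbatim: for a Bateman–Horn system of ONE LINEAR polynomial
`f₀ = αX + β` (`α ≥ 1`, the class `β mod α` prime to `α`), every `j ≥ 1` and every depth `u > 2`,
`N_j(x) = #{1 ≤ n ≤ x : αn + β > 0, no prime p < ⌈x^{1/u}⌉ divides αn + β, Ω(αn + β) = j}`
satisfies `N_j(x)·(log x)/x → (C(f)/∏ deg fᵢ)·I_j(u) = (α/φ(α))·I_j(u)`, `I_j = roughCellDensity j`.
Route (sub-namespace `LinearCells`): `n ↦ αn + β` maps the cell onto the rough Ω-cell of the class
`β mod α` up to `O(1)` (the tree's `LinearRoughValues.card_eq_card_filter`, refined by `Ω`);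
the rough Ω-cells are equidistributed over the reduced classes
(`RoughCellsAP.exists_abs_cellClassDisc_le`); Alladi's theorem with a rate
(`exists_abs_roughCell_sub_main_le`); continuity of `I_j`; `C(f) = α/φ(α)`
(`IncrementAnchoring.LinearRoughValueLaw.const_of_linear`).  The bookkeeping imitates
`IncrementAnchoring.LinearRoughValueLaw.tendsto_card_filter_linear` (the same law without `Ω`).
Everything used is PROVED in the tree; no definition, no new fact.

References: K. Alladi, *The distribution of ν(n) in the sieve of Eratosthenes*, Quart. J. Math.
Oxford (2) 33 (1982), 129–148, Thm 1; G. Tenenbaum, *Introduction to analytic and probabilistic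
number theory*, Ch. III.6.
-/

noncomputable section

open Filter Finset Polynomial
open scoped BigOperators Topology ArithmeticFunction.Omega
open Literature.NumberTheory.Sieve

namespace Summit.Parity.BatemanHorn.Cruxes.RoughValueLaw.OmegaClassShapeSplit

namespace LinearCells

/-! ### The dictionary `n ↦ αn + β`, refined by `Ω` -/

/-- For `α ≥ 1` and `n` in the sifted set `{1 ≤ n ≤ x : αn + β > 0, p < T prime ⇒ p ∤ αn + β}`,
`m = αn + β` is a `T`-rough number `≤ αx + β` of the class `β mod α` with `m ≥ α + β`
(adapted from the first step of `LinearRoughValues.card_eq_card_filter`). [folklore] -/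
theorem toNat_mem_filter {α β : ℤ} (hα : 0 < α) {T x n : ℕ}
    (hn : n ∈ (Icc 1 x).filter (fun n : ℕ => 0 < α * n + β ∧
        ∀ p ∈ range T, p.Prime → ¬ ((p : ℤ) ∣ α * n + β))) :
    (α * n + β).toNat ∈ ((roughIcc T ⌊(α : ℝ) * x + β⌋₊).filter
        (· ≡ (β % α).toNat [MOD α.toNat])).filter (fun m : ℕ => α + β ≤ (m : ℤ)) := by
  -- adapted from `Literature.NumberTheory.Sieve.LinearRoughValues.card_eq_card_filter`
  rw [mem_filter, mem_Icc] at hn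
  obtain ⟨⟨hn1, hnx⟩, hpos, hprime⟩ := hn
  have hmZ : (((α * n + β).toNat : ℕ) : ℤ) = α * n + β := Int.toNat_of_nonneg hpos.le
  rw [mem_filter, mem_filter, mem_roughIcc, LinearRoughValues.modEq_toNat_iff hα]
  refine ⟨⟨⟨⟨by omega, ?_⟩, fun p hp hpm => ?_⟩, ?_⟩, ?_⟩
  · refine Nat.le_floor ?_
    have hnx' : (n : ℤ) ≤ x := by exact_mod_cast hnx
    have h1 : (((α * n + β).toNat : ℕ) : ℤ) ≤ α * x + β := by rw [hmZ]; nlinarith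
    exact_mod_cast h1
  · by_contra hlt
    refine hprime p (mem_range.mpr (not_le.mp hlt)) hp ?_
    rw [← hmZ]
    exact_mod_cast hpm
  · rw [hmZ, add_comm, Int.add_mul_emod_self_left]
  · rw [hmZ]
    have hn1' : (1 : ℤ) ≤ n := by exact_mod_cast hn1
    nlinarith

/-- `n ↦ αn + β` is injective on the sifted set (there `αn + β > 0`, and `α ≥ 1`). [folklore] -/
theorem injOn_toNat {α β : ℤ} (hα : 0 < α) (T x : ℕ) :
    Set.InjOn (fun n : ℕ => (α * n + β).toNat) ↑((Icc 1 x).filter (fun n : ℕ => 0 < α * n + β ∧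
        ∀ p ∈ range T, p.Prime → ¬ ((p : ℤ) ∣ α * n + β))) := by
  intro n₁ hn₁ n₂ hn₂ h
  have h1 : 0 < α * n₁ + β := (mem_filter.mp (mem_coe.mp hn₁)).2.1
  have h2 : 0 < α * n₂ + β := (mem_filter.mp (mem_coe.mp hn₂)).2.1
  have e : α * n₁ + β = α * n₂ + β := by
    have h' := congrArg (Nat.cast (R := ℤ)) h
    simpa only [Int.toNat_of_nonneg h1.le, Int.toNat_of_nonneg h2.le] using h'
  exact_mod_cast (mul_left_cancel₀ hα.ne' (add_right_cancel e) : (n₁ : ℤ) = n₂)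

/-- The image of the sifted set under `n ↦ αn + β` IS the class set of
`LinearRoughValues.card_eq_card_filter` (contained in it, with the same cardinality). [folklore] -/
theorem image_eq {α β : ℤ} (hα : 0 < α) (T x : ℕ) :
    ((Icc 1 x).filter (fun n : ℕ => 0 < α * n + β ∧
        ∀ p ∈ range T, p.Prime → ¬ ((p : ℤ) ∣ α * n + β))).image
        (fun n : ℕ => (α * n + β).toNat) =
      ((roughIcc T ⌊(α : ℝ) * x + β⌋₊).filter (· ≡ (β % α).toNat [MOD α.toNat])).filter
        (fun m : ℕ => α + β ≤ (m : ℤ)) := by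
  refine eq_of_subset_of_card_le (fun m hm => ?_) ?_
  · exact (mem_image.mp hm).elim fun n hn => hn.2 ▸ toNat_mem_filter hα hn.1
  · rw [← LinearRoughValues.card_eq_card_filter α β hα T x,
      card_image_of_injOn (injOn_toNat hα T x)]

/-- **The Ω-cell of the values `αn + β` is an Ω-cell of the class set** (`α ≥ 1`): the bijection
`n ↦ αn + β` preserves the value, hence `Ω`. [folklore] -/
theorem card_filter_cell_eq {α β : ℤ} (hα : 0 < α) (T x j : ℕ) :
    #((Icc 1 x).filter (fun n : ℕ => (0 < α * n + β ∧
        ∀ p ∈ range T, p.Prime → ¬ ((p : ℤ) ∣ α * n + β)) ∧ Ω (α * n + β).toNat = j)) =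
      #((((roughIcc T ⌊(α : ℝ) * x + β⌋₊).filter (· ≡ (β % α).toNat [MOD α.toNat])).filter
        (fun m : ℕ => α + β ≤ (m : ℤ))).filter (fun m : ℕ => Ω m = j)) := by
  rw [← image_eq hα T x, filter_image,
    card_image_of_injOn ((injOn_toNat hα T x).mono (coe_subset.mpr (filter_subset _ _))),
    filter_filter]

/-- **Dictionary up to `O(1)`** (`α ≥ 1`): the cell count of the values `αn + β`, `1 ≤ n ≤ x`, and
`#{m ∈ roughIcc T ⌊αx + β⌋ : Ω m = j, m ≡ β (α)}` differ by at most `(α + β)⁺` (the missing `m` lie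
below `α + β`; adapted from `LinearRoughValues.abs_card_sub_card_filter_le`). [folklore] -/
theorem abs_card_cell_sub_le {α β : ℤ} (hα : 0 < α) (T x j : ℕ) :
    |(#((Icc 1 x).filter (fun n : ℕ => (0 < α * n + β ∧
        ∀ p ∈ range T, p.Prime → ¬ ((p : ℤ) ∣ α * n + β)) ∧ Ω (α * n + β).toNat = j)) : ℝ) -
        #((roughIcc T ⌊(α : ℝ) * x + β⌋₊).filter
          (fun m : ℕ => Ω m = j ∧ m ≡ (β % α).toNat [MOD α.toNat]))| ≤ (α + β).toNat := by
  -- adapted from `Literature.NumberTheory.Sieve.LinearRoughValues.abs_card_sub_card_filter_le`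
  rw [card_filter_cell_eq hα T x j]
  set F := (roughIcc T ⌊(α : ℝ) * x + β⌋₊).filter
      (fun m : ℕ => Ω m = j ∧ m ≡ (β % α).toNat [MOD α.toNat]) with hF
  have hE : (((roughIcc T ⌊(α : ℝ) * x + β⌋₊).filter (· ≡ (β % α).toNat [MOD α.toNat])).filter
        (fun m : ℕ => α + β ≤ (m : ℤ))).filter (fun m : ℕ => Ω m = j) =
      F.filter (fun m : ℕ => α + β ≤ (m : ℤ)) := by
    rw [hF, filter_filter, filter_filter, filter_filter]
    exact filter_congr fun m _ => by tauto
  rw [hE]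
  have hsplit := card_filter_add_card_filter_not (s := F) (fun m : ℕ => α + β ≤ (m : ℤ))
  have hsmall : #(F.filter (fun m : ℕ => ¬ (α + β ≤ (m : ℤ)))) ≤ (α + β).toNat := by
    calc _ ≤ #(range (α + β).toNat) := card_le_card fun m hm => by
          rw [mem_filter] at hm
          rw [mem_range]
          omega
      _ = (α + β).toNat := card_range _
  have h1 : (#(F.filter (fun m : ℕ => α + β ≤ (m : ℤ))) : ℝ) - #F =
      -(#(F.filter (fun m : ℕ => ¬ (α + β ≤ (m : ℤ)))) : ℝ) := by
    rw [← hsplit]; push_cast; ring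
  rw [h1, abs_neg, Nat.abs_cast]
  exact_mod_cast hsmall

/-! ### The analytic core -/

/-- `log(αx + β)/log(x^{1/u}) → u` (`α ≥ 1`, `u > 0`): `log(αx + β) = log x + log(α + β/x)`
(verbatim from `IncrementAnchoring.LinearRoughValueLaw.tendsto_card_filter_linear`). [folklore] -/
theorem tendsto_log_div_log {α β : ℤ} (hα : 0 < α) {u : ℝ} (hu0 : 0 < u) :
    Tendsto (fun x : ℕ => Real.log ((α : ℝ) * x + β) / Real.log ((x : ℝ) ^ (1 / u))) atTop
      (𝓝 u) := by
  -- adapted from `IncrementAnchoring.LinearRoughValueLaw.tendsto_card_filter_linear`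
  have hαR1 : (1 : ℝ) ≤ (α : ℝ) := by exact_mod_cast hα
  have hαβ : Tendsto (fun x : ℕ => (α : ℝ) + β / x) atTop (𝓝 (α : ℝ)) := by
    have h : Tendsto (fun x : ℕ => (α : ℝ) + β / x) atTop (𝓝 ((α : ℝ) + 0)) :=
      tendsto_const_nhds.add (tendsto_const_nhds.div_atTop tendsto_natCast_atTop_atTop)
    rwa [add_zero] at h
  have hinv : Tendsto (fun x : ℕ => (Real.log x)⁻¹) atTop (𝓝 0) :=
    tendsto_inv_atTop_zero.comp (Real.tendsto_log_atTop.comp tendsto_natCast_atTop_atTop)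
  have hprod : Tendsto (fun x : ℕ => u * (1 + Real.log ((α : ℝ) + β / x) * (Real.log x)⁻¹))
      atTop (𝓝 (u * (1 + Real.log α * 0))) :=
    tendsto_const_nhds.mul (tendsto_const_nhds.add ((hαβ.log (by positivity)).mul hinv))
  rw [mul_zero, add_zero, mul_one] at hprod
  refine hprod.congr' ?_
  filter_upwards [tendsto_natCast_atTop_atTop.eventually_ge_atTop (|(β : ℝ)| + 2)] with x hx
  have hβge := neg_abs_le (β : ℝ)
  have hx0 : (0 : ℝ) < x := by linarith [abs_nonneg (β : ℝ)]
  have hlogx : Real.log x ≠ 0 := (Real.log_pos (by linarith [abs_nonneg (β : ℝ)])).ne'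
  have hnum : 0 < (α : ℝ) * x + β := by nlinarith
  have hpos : 0 < (α : ℝ) + β / x := by
    have e : (α : ℝ) + β / x = ((α : ℝ) * x + β) / x := by field_simp
    rw [e]; positivity
  rw [Real.log_rpow hx0]
  have e : (α : ℝ) * x + β = x * ((α : ℝ) + β / x) := by field_simp
  rw [e, Real.log_mul hx0.ne' hpos.ne']
  field_simp

/-- **The normalised main term.** With `X = αx + β`, `Y = x^{1/u}` (`α ≥ 1`, `u > 1`) and any `φ`,
`(X I_{j+1}(log X/log Y)/log X − [j = 0] Y/log Y)/φ · (log x)/x → (α/φ) I_{j+1}(u)`: `X/x → α`,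
`log x/log X → 1`, `log X/log Y → u`, `I_{j+1}` continuous at `u`, `Y log x/(x log Y) → 0`.
[folklore] -/
theorem tendsto_mainTerm {α β : ℤ} (hα : 0 < α) (j : ℕ) {u : ℝ} (hu1 : 1 < u) (φ : ℝ) :
    Tendsto (fun x : ℕ => (((α : ℝ) * x + β) * roughCellDensity (j + 1)
        (Real.log ((α : ℝ) * x + β) / Real.log ((x : ℝ) ^ (1 / u))) / Real.log ((α : ℝ) * x + β) -
        (if j = 0 then (x : ℝ) ^ (1 / u) / Real.log ((x : ℝ) ^ (1 / u)) else 0)) / φ *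
          (Real.log x / x)) atTop (𝓝 ((α : ℝ) / φ * roughCellDensity (j + 1) u)) := by
  have hu0 : 0 < u := by linarith
  have hαR1 : (1 : ℝ) ≤ (α : ℝ) := by exact_mod_cast hα
  obtain ⟨z, hz⟩ : ∃ z : ℕ → ℝ, ∀ x, z x = (x : ℝ) ^ (1 / u) := ⟨_, fun _ => rfl⟩
  obtain ⟨Xr, hXr⟩ : ∃ X : ℕ → ℝ, ∀ x, X x = (α : ℝ) * x + β := ⟨_, fun _ => rfl⟩
  have hr : Tendsto (fun x : ℕ => Real.log (Xr x) / Real.log (z x)) atTop (𝓝 u) :=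
    (tendsto_log_div_log (β := β) hα hu0).congr fun x => by rw [hXr, hz]
  have hXx : Tendsto (fun x : ℕ => Xr x / x) atTop (𝓝 (α : ℝ)) := by
    have h : Tendsto (fun x : ℕ => (α : ℝ) + β / x) atTop (𝓝 ((α : ℝ) + 0)) :=
      tendsto_const_nhds.add (tendsto_const_nhds.div_atTop tendsto_natCast_atTop_atTop)
    rw [add_zero] at h
    refine h.congr' ?_
    filter_upwards [tendsto_natCast_atTop_atTop.eventually_ge_atTop (1 : ℝ)] with x hx
    have hx0 : (0 : ℝ) < x := by linarith
    rw [hXr]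
    field_simp
  have hI : Tendsto (fun x : ℕ => roughCellDensity (j + 1) (Real.log (Xr x) / Real.log (z x)))
      atTop (𝓝 (roughCellDensity (j + 1) u)) :=
    (continuousAt_roughCellDensity (j + 1) hu1).tendsto.comp hr
  have hL : Tendsto (fun x : ℕ => Real.log x / Real.log (Xr x)) atTop (𝓝 1) := by
    have h := (tendsto_const_nhds (x := u)).div hr hu0.ne'
    rw [div_self hu0.ne'] at h
    refine h.congr' ?_
    filter_upwards [tendsto_natCast_atTop_atTop.eventually_ge_atTop (|(β : ℝ)| + 2)] with x hx
    have hβge := neg_abs_le (β : ℝ)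
    have hx0 : (0 : ℝ) < x := by linarith [abs_nonneg (β : ℝ)]
    have hlogx : Real.log x ≠ 0 := (Real.log_pos (by linarith [abs_nonneg (β : ℝ)])).ne'
    have hlogX : Real.log (Xr x) ≠ 0 := (Real.log_pos (by rw [hXr]; nlinarith)).ne'
    rw [Pi.div_apply, hz, Real.log_rpow hx0]
    field_simp
  have hzx : Tendsto (fun x : ℕ => z x / Real.log (z x) * (Real.log x / x)) atTop (𝓝 0) := by
    have hexp : 0 < 1 - 1 / u := by
      have : 1 / u < 1 := by rw [div_lt_one hu0]; exact hu1
      linarith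
    have h : Tendsto (fun x : ℕ => u * ((x : ℝ) ^ (-(1 - 1 / u)))) atTop (𝓝 (u * 0)) :=
      ((tendsto_rpow_neg_atTop hexp).comp tendsto_natCast_atTop_atTop).const_mul u
    rw [mul_zero] at h
    refine h.congr' ?_
    filter_upwards [tendsto_natCast_atTop_atTop.eventually_ge_atTop (2 : ℝ)] with x hx
    have hx0 : (0 : ℝ) < x := by linarith
    have hlogx : Real.log x ≠ 0 := (Real.log_pos (by linarith)).ne'
    rw [hz, Real.log_rpow hx0, neg_sub, Real.rpow_sub_one hx0.ne']
    field_simp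
  have hD : Tendsto (fun x : ℕ => (if j = 0 then z x / Real.log (z x) else 0) / φ *
      (Real.log x / x)) atTop (𝓝 0) := by
    by_cases hj0 : j = 0
    · simp only [hj0, ↓reduceIte]
      have h := hzx.div_const φ
      rw [zero_div] at h
      exact h.congr fun x => by ring
    · simp only [hj0, ↓reduceIte, zero_div, zero_mul]
      exact tendsto_const_nhds
  have hall := (((hXx.mul hI).mul hL).div_const φ).sub hD
  rw [mul_one, sub_zero, show (α : ℝ) * roughCellDensity (j + 1) u / φ =
    (α : ℝ) / φ * roughCellDensity (j + 1) u by ring] at hall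
  refine hall.congr fun x => ?_
  rw [hXr, hz]
  ring

/-- **The ranges, eventually.** With `X = αx + β`, `Y = x^{1/u}` (`α ≥ 1`, `u > 2`), for all large
`x`: `x > 0`, `log x > 0`, `Y ≥ 2`, `Y > α`, `Y ≤ X`, `log X ≤ (⌈u⌉ + 1) log Y`, `X ≤ (α + 1) x`
(`Y² = x^{2/u} ≤ x` and `X ≤ (α + 1) x ≤ x Y`). [folklore] -/
theorem eventually_ranges {α β : ℤ} (hα : 0 < α) {u : ℝ} (hu : 2 < u) :
    ∀ᶠ x : ℕ in atTop, 0 < (x : ℝ) ∧ 0 < Real.log x ∧ 2 ≤ (x : ℝ) ^ (1 / u) ∧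
      (α : ℝ) < (x : ℝ) ^ (1 / u) ∧ (x : ℝ) ^ (1 / u) ≤ (α : ℝ) * x + β ∧
      Real.log ((α : ℝ) * x + β) ≤ ((⌈u⌉₊ + 1 : ℕ) : ℝ) * Real.log ((x : ℝ) ^ (1 / u)) ∧
      (α : ℝ) * x + β ≤ ((α : ℝ) + 1) * x := by
  have hu0 : 0 < u := by linarith
  have hαR1 : (1 : ℝ) ≤ (α : ℝ) := by exact_mod_cast hα
  obtain ⟨z, hz⟩ : ∃ z : ℕ → ℝ, ∀ x, z x = (x : ℝ) ^ (1 / u) := ⟨_, fun _ => rfl⟩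
  have hz_tend : Tendsto z atTop atTop :=
    ((tendsto_rpow_atTop (by positivity : (0 : ℝ) < 1 / u)).comp
      tendsto_natCast_atTop_atTop).congr fun x => (hz x).symm
  filter_upwards [hz_tend.eventually_ge_atTop ((α : ℝ) + 2),
    tendsto_natCast_atTop_atTop.eventually_ge_atTop (2 * |(β : ℝ)| + 2)] with x hza hx3
  rw [← hz]
  have hβle := le_abs_self (β : ℝ)
  have hβge := neg_abs_le (β : ℝ)
  have hx1 : (1 : ℝ) < x := by linarith [abs_nonneg (β : ℝ)]
  have hx0 : (0 : ℝ) < x := by linarith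
  have hz0 : 0 < z x := by linarith
  have hXr0 : 0 < (α : ℝ) * x + β := by nlinarith
  have hXrx : (α : ℝ) * x + β ≤ ((α : ℝ) + 1) * x := by nlinarith
  have hlz : Real.log x = u * Real.log (z x) := by
    rw [hz, Real.log_rpow hx0]; field_simp
  have hz2x : z x ^ 2 ≤ x := by
    have h := Real.rpow_le_rpow_of_exponent_le hx1.le
      (show 1 / u * 2 ≤ 1 by rw [div_mul_eq_mul_div, one_mul, div_le_one hu0]; exact hu.le)
    rwa [Real.rpow_mul hx0.le, Real.rpow_two, ← hz, Real.rpow_one] at h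
  have h2z : 2 * z x ≤ z x ^ 2 := by nlinarith
  have hzX : z x ≤ (α : ℝ) * x + β := by nlinarith
  have hlogle : Real.log ((α : ℝ) * x + β) ≤ ((⌈u⌉₊ + 1 : ℕ) : ℝ) * Real.log (z x) := by
    have h1 : Real.log ((α : ℝ) * x + β) ≤ Real.log (z x) + u * Real.log (z x) := by
      rw [← hlz, ← Real.log_mul hz0.ne' hx0.ne']
      exact Real.log_le_log hXr0 (by nlinarith)
    have hlogz : 0 ≤ Real.log (z x) := Real.log_nonneg (by linarith)
    have h2 : u + 1 ≤ ((⌈u⌉₊ + 1 : ℕ) : ℝ) := by push_cast; linarith [Nat.le_ceil u]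
    nlinarith
  exact ⟨hx0, Real.log_pos hx1, by linarith, by linarith, hzX, hlogle, hXrx⟩

/-- Bookkeeping: the two `O(X/log² Y)` discrepancies (class cell against cell`/φ`, cell against
main term) combine to `|Φc − Mn/φ| ≤ (C₁ + C₂) X/log² Y` (`φ ≥ 1`). [folklore] -/
theorem abs_sub_div_le {Φc Φ Mn φ C₁ C₂ X L : ℝ} (hφ0 : 0 < φ) (hφ1 : 1 ≤ φ)
    (hA : |Φc - Φ / φ| ≤ C₁ * X / L ^ 2) (hB : |Φ - Mn| ≤ C₂ * X / L ^ 2) :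
    |Φc - Mn / φ| ≤ (C₁ + C₂) * X / L ^ 2 := by
  rw [show Φc - Mn / φ = (Φc - Φ / φ) + (Φ - Mn) / φ by ring]
  refine (abs_add_le _ _).trans ?_
  rw [abs_div, abs_of_pos hφ0]
  have hB' : |Φ - Mn| / φ ≤ C₂ * X / L ^ 2 := (div_le_self (abs_nonneg _) hφ1).trans hB
  calc |Φc - Φ / φ| + |Φ - Mn| / φ ≤ C₁ * X / L ^ 2 + C₂ * X / L ^ 2 := add_le_add hA hB'
    _ = (C₁ + C₂) * X / L ^ 2 := by ring

/-- **Alladi's theorem for the rough values of `αn + β`, sorted by `Ω`** (Alladi 1982, Thm 1, in the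
progression `β mod α`): for `α ≥ 1`, `β` with the class `β mod α` prime to `α`, `j`, `u > 2`,
`#{1 ≤ n ≤ x : αn + β > 0, p < x^{1/u} prime ⇒ p ∤ αn + β, Ω(αn + β) = j + 1}·(log x)/x` tends to
`(α/φ(α)) I_{j+1}(u)`: class cell count plus `O(1)` (`abs_card_cell_sub_le`), cell count over `φ(α)`
plus `O(X/log² Y)` (`RoughCellsAP.exists_abs_cellClassDisc_le`), Alladi's main term plus
`O(X/log² Y)` (`exists_abs_roughCell_sub_main_le`), and `tendsto_mainTerm`. [folklore] -/
theorem tendsto_card_filter_linear_cell {α β : ℤ} (hα : 0 < α)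
    (hcop : ((β % α).toNat).Coprime α.toNat) (j : ℕ) {u : ℝ} (hu : 2 < u) :
    Tendsto (fun x : ℕ => (#((Icc 1 x).filter (fun n : ℕ => (0 < α * n + β ∧
        ∀ p ∈ range ⌈(x : ℝ) ^ (1 / u)⌉₊, p.Prime → ¬ ((p : ℤ) ∣ α * n + β)) ∧
          Ω (α * n + β).toNat = j + 1)) : ℝ) * Real.log x / x) atTop
      (𝓝 ((α : ℝ) / (((α.toNat).totient : ℕ) : ℝ) * roughCellDensity (j + 1) u)) := by
  set a : ℕ := α.toNat with ha_def
  have haα : (a : ℤ) = α := Int.toNat_of_nonneg hα.le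
  have ha0 : 0 < a := by omega
  have hαa : (α : ℝ) = (a : ℝ) := by exact_mod_cast haα.symm
  set c : ℕ := (β % α).toNat with hc_def
  set φ : ℝ := ((a.totient : ℕ) : ℝ) with hφ_def
  have hφ1 : 1 ≤ φ := by rw [hφ_def]; exact_mod_cast Nat.totient_pos.mpr ha0
  have hφ0 : 0 < φ := by linarith
  have hu1 : 1 < u := by linarith
  obtain ⟨z, hz⟩ : ∃ z : ℕ → ℝ, ∀ x, z x = (x : ℝ) ^ (1 / u) := ⟨_, fun _ => rfl⟩
  obtain ⟨Xr, hXr⟩ : ∃ X : ℕ → ℝ, ∀ x, X x = (α : ℝ) * x + β := ⟨_, fun _ => rfl⟩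
  obtain ⟨cnt, hcnt⟩ : ∃ g : ℕ → ℝ, ∀ x, g x = (#((Icc 1 x).filter (fun n : ℕ =>
      (0 < α * n + β ∧ ∀ p ∈ range ⌈(x : ℝ) ^ (1 / u)⌉₊, p.Prime → ¬ ((p : ℤ) ∣ α * n + β)) ∧
        Ω (α * n + β).toNat = j + 1)) : ℝ) := ⟨_, fun _ => rfl⟩
  obtain ⟨Φc, hΦc⟩ : ∃ g : ℕ → ℝ, ∀ x, g x = (#((roughIcc ⌈z x⌉₊ ⌊Xr x⌋₊).filter
      (fun b => Ω b = j + 1 ∧ b ≡ c [MOD a])) : ℝ) := ⟨_, fun _ => rfl⟩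
  obtain ⟨Φ, hΦ⟩ : ∃ g : ℕ → ℝ, ∀ x, g x = (#((roughIcc ⌈z x⌉₊ ⌊Xr x⌋₊).filter
      (fun b => Ω b = j + 1)) : ℝ) := ⟨_, fun _ => rfl⟩
  obtain ⟨Mn, hMn⟩ : ∃ g : ℕ → ℝ, ∀ x, g x =
      Xr x * roughCellDensity (j + 1) (Real.log (Xr x) / Real.log (z x)) / Real.log (Xr x) -
        (if j = 0 then z x / Real.log (z x) else 0) := ⟨_, fun _ => rfl⟩
  -- count = class cell + O(1) = cell/φ + O(X/log² Y) = main term/φ + O(X/log² Y); then the limit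
  have h1 : Tendsto (fun x : ℕ => Real.log x / (x : ℝ) * (cnt x - Φc x)) atTop (𝓝 0) := by
    have hlog : Tendsto (fun x : ℕ => Real.log x / (x : ℝ)) atTop (𝓝 0) :=
      ((Real.tendsto_pow_log_div_mul_add_atTop 1 0 1 one_ne_zero).comp
        tendsto_natCast_atTop_atTop).congr fun x => by simp
    refine hlog.zero_mul_isBoundedUnder_le (Filter.isBoundedUnder_of ⟨((α + β).toNat : ℝ), ?_⟩)
    intro x
    rw [Function.comp_apply, Real.norm_eq_abs, hcnt, hΦc, hz, hXr]
    exact abs_card_cell_sub_le hα _ x (j + 1)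
  have h2 : Tendsto (fun x : ℕ => (Φc x - Mn x / φ) * (Real.log x / x)) atTop (𝓝 0) := by
    obtain ⟨C₁, hC₁, hcl⟩ := RoughCellsAP.exists_abs_cellClassDisc_le a ha0 (⌈u⌉₊ + 1)
    obtain ⟨C₂, hC₂, hal⟩ := exists_abs_roughCell_sub_main_le j (⌈u⌉₊ + 1)
    have hKlog : Tendsto (fun x : ℕ => (C₁ + C₂) * u ^ 2 * ((α : ℝ) + 1) / Real.log x) atTop
        (𝓝 0) :=
      tendsto_const_nhds.div_atTop (Real.tendsto_log_atTop.comp tendsto_natCast_atTop_atTop)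
    refine squeeze_zero_norm' ?_ hKlog
    filter_upwards [eventually_ranges (β := β) hα hu] with x ⟨hx0, hlogx, hz2, hqz, hzX, hlogle,
      hXrx⟩
    rw [← hz] at hz2 hqz hzX hlogle
    rw [← hXr] at hzX hlogle hXrx
    rw [hαa] at hqz
    have hA := hcl (Xr x) (z x) hz2 hzX hlogle hqz j c hcop
    have hB := hal (Xr x) (z x) hz2 hzX hlogle
    rw [← hΦc x, ← hΦ x] at hA
    rw [← hΦ x, ← hMn x] at hB
    have hcomb : |Φc x - Mn x / φ| ≤ (C₁ + C₂) * Xr x / Real.log (z x) ^ 2 :=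
      abs_sub_div_le hφ0 hφ1 hA hB
    have hlz : Real.log (z x) = 1 / u * Real.log x := by rw [hz, Real.log_rpow hx0]
    have hdiv : Xr x / x ≤ (α : ℝ) + 1 := by rw [div_le_iff₀ hx0]; exact hXrx
    have hC : 0 ≤ C₁ + C₂ := by positivity
    rw [norm_mul, Real.norm_eq_abs, Real.norm_eq_abs,
      abs_of_nonneg (show (0 : ℝ) ≤ Real.log x / x by positivity)]
    calc |Φc x - Mn x / φ| * (Real.log x / x)
        ≤ (C₁ + C₂) * Xr x / Real.log (z x) ^ 2 * (Real.log x / x) := by gcongr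
      _ = (C₁ + C₂) * u ^ 2 * (Xr x / x) / Real.log x := by rw [hlz]; field_simp
      _ ≤ (C₁ + C₂) * u ^ 2 * ((α : ℝ) + 1) / Real.log x := by gcongr
  have h3 : Tendsto (fun x : ℕ => Mn x / φ * (Real.log x / x)) atTop
      (𝓝 ((α : ℝ) / φ * roughCellDensity (j + 1) u)) :=
    (tendsto_mainTerm (β := β) hα j hu1 φ).congr fun x => by rw [hMn, hXr, hz]
  have hsum := (h1.add h2).add h3
  rw [zero_add, zero_add] at hsum
  refine hsum.congr fun x => ?_
  rw [hcnt x]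
  ring

end LinearCells

/-- **stub_linearCells** (the linear sector of the Ω-cell shape law).  For a Bateman–Horn system of
ONE LINEAR polynomial `f₀ = αX + β` every Ω-cell has Alladi's shape with the Hardy–Littlewood
amplitude: `N_{f,j}(x,u)·(log x)/x → (C(f)/∏ deg fᵢ)·I_j(u)`, `C(f) = α/φ(α)`, for `j ≥ 1`, `u > 2`
(`LinearCells.tendsto_card_filter_linear_cell`, `LinearRoughValueLaw.const_of_linear`).
[folklore] -/
theorem stub_linearCells :
    ∀ (f : Fin 1 → ℤ[X]), IsBatemanHornSystem f → (f 0).natDegree = 1 → ∀ r : Fin 1 → ℕ, (∀ i, 1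
      ≤ r i) → ∀ u : ℝ, 2 < u → Tendsto (fun x : ℕ => (((Icc 1 x).filter (fun n : ℕ => (∀ i, 0 <
      (f i).eval (n : ℤ) ∧ ∀ p ∈ range ⌈(x : ℝ) ^ (((f i).natDegree : ℝ) / u)⌉₊, p.Prime → ¬ ((p
      : ℤ) ∣ (f i).eval (n : ℤ))) ∧ ∀ i, ArithmeticFunction.cardFactors ((f i).eval (n :
      ℤ)).toNat = r i)).card : ℝ) * Real.log x ^ 1 / x - batemanHornConst f / (∏ i, ((f
      i).natDegree : ℝ)) * ∏ i, roughCellDensity (r i) u) atTop (𝓝 0) := by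
  intro f hf hdeg r hr u hu
  obtain ⟨hα, hcop, hconst⟩ := IncrementAnchoring.LinearRoughValueLaw.const_of_linear hf hdeg
  obtain ⟨j, hj⟩ : ∃ j, r 0 = j + 1 :=
    Nat.exists_eq_add_one_of_ne_zero (Nat.one_le_iff_ne_zero.mp (hr 0))
  have hprod : (∏ i : Fin 1, ((f i).natDegree : ℝ)) = 1 := by
    rw [Fin.prod_univ_one, hdeg, Nat.cast_one]
  rw [hprod, div_one, Fin.prod_univ_one, hj, hconst]
  have hg : ∀ n : ℕ, (f 0).eval (n : ℤ) = (f 0).coeff 1 * n + (f 0).coeff 0 := fun n => by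
    conv_lhs => rw [eq_X_add_C_of_natDegree_le_one hdeg.le]
    simp only [eval_add, eval_mul, eval_C, eval_X]
  have h0 := (LinearCells.tendsto_card_filter_linear_cell hα hcop j hu).sub_const
    (((f 0).coeff 1 : ℝ) / (((((f 0).coeff 1).toNat).totient : ℕ) : ℝ) * roughCellDensity (j + 1) u)
  rw [sub_self] at h0
  refine h0.congr fun x => ?_
  simp only [Fin.forall_fin_one, hg, hdeg, Nat.cast_one, hj, pow_one]

end Summit.Parity.BatemanHorn.Cruxes.RoughValueLaw.OmegaClassShapeSplit
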